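import Literature.NumberTheory.NumberFields.TableAlgebra
import Mathlib.Algebra.Field.ZMod
import HarnessLib

/-!
# Table algebras over `ℤ/p` generated by a nilpotent: the key lemma for `p`-saturation at a totally ramified prime

Topic `NumberTheory/NumberFields` (complement to `TableAlgebra.lean`). Let `A = TAlg S (ℤ/p)` be the
reduction modulo a prime `p` of an order `Λ = TAlg S ℤ` of rank `5`, and suppose an element `ε ∈ A`
satisfies `ε⁵ = 0` and `1, ε, …, ε⁴` span `A` (the situation `Λ/pΛ ≅ 𝔽_p[ε]/(ε⁵)` of an order which is
maximal at a prime `p` TOTALLY RAMIFIED in a quintic field, `(p) = 𝔭⁵`, `ε ∈ 𝔭 ∖ 𝔭²`). Then **every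
non-zero `y ∈ A` divides a unit multiple of `ε⁴`**: `εᵏ · y = c · ε⁴` for some `k ≤ 4` and `c ∈ (ℤ/p)ˣ`
(`TAlg.exists_pow_mul_eq_const_mul_pow_four`: expand `y = Σ aₖ εᵏ`, take the least `m` with `aₘ ≠ 0`,
`k = 4 - m`). In the orders of the quintic fields of conductor `2651`
(`CyclicQuinticField2651K*Integers.lean`) this shows that a `y ∈ Λ ∖ pΛ` with `y/p` integral would make
`ε⁴/p` integral, which the norm forbids — so `Λ` is `p`-saturated although the prime above `p` is not
principal. Everything is proved; no number theory is used here.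

## References

* M. Pohst, H. Zassenhaus, *Algorithmic Algebraic Number Theory* (1989), §4.6 (local maximality of
  orders; the radical at a totally ramified prime). [folklore]
-/

open Finset

namespace Literature.NumberTheory.NumberFields

namespace TAlg

variable {S : TableSpec 5} [Fact S.IsRing] {p : ℕ} [Fact p.Prime]

/-- **Coordinates on the powers of `ε`**: if every basis vector is a combination of `1, ε, …, ε⁴`
with the coefficient matrix `B`, then so is every element, with coefficients `aₖ(y) = Σ_b y_b B b k`.
[folklore] -/
theorem eq_sum_pow_of_basis (ε : TAlg S (ZMod p)) (B : Fin 5 → Fin 5 → ZMod p)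
    (hB : ∀ b, (basis b : TAlg S (ZMod p)) = ∑ k : Fin 5, const (B b k) * ε ^ (k : ℕ)) (y : TAlg S (ZMod p)) :
    y = ∑ k : Fin 5, const (∑ b, y.coef b * B b k) * ε ^ (k : ℕ) := by
  conv_lhs => rw [eq_sum_basis y]
  simp_rw [hB, Finset.mul_sum, map_sum, Finset.sum_mul]
  rw [Finset.sum_comm]
  refine Finset.sum_congr rfl fun k _ => Finset.sum_congr rfl fun b _ => ?_
  rw [map_mul, mul_assoc]

/-- **The key lemma.** If `ε⁵ = 0` and `1, ε, …, ε⁴` span `A = TAlg S (ℤ/p)`, then for every `y ≠ 0`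
there are `k ≤ 4` and `c ≠ 0` in `ℤ/p` with `εᵏ · y = c · ε⁴`. [folklore] -/
theorem exists_pow_mul_eq_const_mul_pow_four (ε : TAlg S (ZMod p)) (B : Fin 5 → Fin 5 → ZMod p)
    (hB : ∀ b, (basis b : TAlg S (ZMod p)) = ∑ k : Fin 5, const (B b k) * ε ^ (k : ℕ)) (hε : ε ^ 5 = 0)
    {y : TAlg S (ZMod p)} (hy : y ≠ 0) :
    ∃ k : ℕ, k ≤ 4 ∧ ∃ c : ZMod p, c ≠ 0 ∧ ε ^ k * y = const c * ε ^ 4 := by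
  classical
  set a : Fin 5 → ZMod p := fun k => ∑ b, y.coef b * B b k with ha
  have hy' : y = ∑ k : Fin 5, const (a k) * ε ^ (k : ℕ) := eq_sum_pow_of_basis ε B hB y
  -- some coefficient is non-zero
  have hex : ∃ k, a k ≠ 0 := by
    by_contra hall
    simp only [not_exists, not_not] at hall
    apply hy
    rw [hy']
    simp [hall]
  -- the least such index
  have hne : (Finset.univ.filter fun k => a k ≠ 0).Nonempty := by
    obtain ⟨k, hk⟩ := hex
    exact ⟨k, Finset.mem_filter.mpr ⟨Finset.mem_univ k, hk⟩⟩
  set m : Fin 5 := (Finset.univ.filter fun k => a k ≠ 0).min' hne with hmdef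
  have hm : a m ≠ 0 := by
    have := Finset.min'_mem _ hne
    rw [← hmdef, Finset.mem_filter] at this
    exact this.2
  have hmin : ∀ k : Fin 5, a k ≠ 0 → m ≤ k := fun k hk => by
    rw [hmdef]
    exact Finset.min'_le _ _ (Finset.mem_filter.mpr ⟨Finset.mem_univ k, hk⟩)
  have hpow : ∀ e : ℕ, 5 ≤ e → ε ^ e = 0 := fun e he => by
    obtain ⟨d, rfl⟩ := Nat.exists_eq_add_of_le he
    rw [pow_add, hε, zero_mul]
  refine ⟨4 - (m : ℕ), by omega, a m, hm, ?_⟩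
  rw [hy', Finset.mul_sum]
  -- only the term `k = m` survives
  rw [Finset.sum_eq_single m]
  · rw [mul_left_comm, ← pow_add]
    congr 2
    have := m.isLt
    omega
  · intro k _ hkm
    by_cases hak : a k = 0
    · rw [hak, map_zero, zero_mul, mul_zero]
    · have hlt : (m : ℕ) < k := by
        have := hmin k hak
        exact lt_of_le_of_ne this (fun h => hkm (Fin.ext h).symm)
      rw [mul_left_comm, ← pow_add, hpow _ (by omega), mul_zero]
  · intro h; exact absurd (Finset.mem_univ m) h

/-- **Reduction modulo `m` has kernel `mΛ`**: an element of `TAlg S ℤ` whose reduction in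
`TAlg S (ℤ/m)` vanishes is `m` times an element. [folklore] -/
theorem exists_eq_natCast_mul_of_map_eq_zero {S' : TableSpec 5} [Fact S'.IsRing] (m : ℕ) {y : TAlg S' ℤ}
    (h : map (Int.castRingHom (ZMod m)) y = 0) : ∃ y' : TAlg S' ℤ, y = (m : TAlg S' ℤ) * y' := by
  have hc : ∀ b, (m : ℤ) ∣ y.coef b := fun b => by
    have := congrArg (fun z : TAlg S' (ZMod m) => z.coef b) h
    simp only [map_coef, zero_coef, Int.coe_castRingHom] at this
    exact (ZMod.intCast_zmod_eq_zero_iff_dvd _ _).mp this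
  choose q hq using hc
  refine ⟨⟨q⟩, ?_⟩
  ext b
  have e : ((m : TAlg S' ℤ)) = ⟨fun a => (m : ℤ) * (S'.one a : ℤ)⟩ := by ext a; simp
  have h2 := const_mul_coef' (S := S') (R := ℤ) (m : ℤ) ⟨q⟩ b
  simp only [Int.cast_id] at h2
  rw [e, h2]
  exact hq b

end TAlg

end Literature.NumberTheory.NumberFields
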